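import Summits.Schanuel.Schanuel.Theses.GaussianStokesSector
import Summits.Schanuel.Schanuel.Theses.DiophantineDichotomy
import Summits.Schanuel.Schanuel.Theorems.DiophantineDichotomyEPiRaceEv
import Summits.Schanuel.Schanuel.Theorems.DiophantineDichotomyApproximationPropertyDegOne

/-!
# Birth skeleton (BC3) for piece X₁ `EPiAlgIndependent` (stmt-Schanuel-18739): e ⊥ π via the
Diophantine race of route `DiophantineDichotomy`

`e ⊥ π` is Schanuel's flagship open instance; this skeleton does not pretend to a new attack — it
records the tree's LIVE TYPED STRUCTURE around it: the landed race
`Summit.Schanuel.Schanuel.Theorems.ePiRaceEv_proof : DiophantineDichotomy.EPiRaceEv`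
(= AP₁(π, e) → EPiSimultaneousTypeEv → AlgebraicIndependent ℚ ![e, π]) composed with its two inputs
as stubs:
* `stub_approximationPropertyAtEPi` — the level-1 approximation property at θ = (π, e) (KNOWN:
  the instance ι = Fin 2, θ = ![π, e] of the PROVED item `DiophantineDichotomy.ApproximationPropertyDegOne`,
  `Theorems.approximationPropertyDegOne_proof`; Laurent–Roy 1999 / Bugeaud 2004 Thm 8.11; kept as
  a named stub so that the skeleton shows both inputs of the race — dischargeable now);
* `stub_ePiSimultaneousTypeEv` — the EVENTUAL SIMULTANEOUS APPROXIMATION MEASURE for (π, e) with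
  exponent a < 1 (open support item stmt-Schanuel-14975 of route DiophantineDichotomy: the genuine
  open input; "e and π are algebraically independent with a Philippon-criterion-shaped measure").
-/

namespace Summit.Schanuel.Schanuel.Cruxes.EPiAlgIndependent.DiophantineRace

open Summit.Schanuel.Schanuel.Theses

/-- STUB 1 (KNOWN, dischargeable by `approximationPropertyDegOne_proof (Fin 2) ![(π:ℂ), (e:ℂ)]`):
the t = 1 approximation property at θ = (π, e). -/
theorem stub_approximationPropertyAtEPi :
    Algebra.trdeg ℚ ↥(IntermediateField.adjoin ℚ (Set.range ![(Real.pi : ℂ), (Real.exp 1 : ℂ)])) ≤ (1 : Cardinal) → ∃ c : ℝ, 1 ≤ c ∧ ∀ Δ Y : ℝ, c ≤ Δ → Δ ≤ Y → ∃ (γ : Fin 2 → ℂ) (d H : ℕ), Module.finrank ℚ ↥(IntermediateField.adjoin ℚ (Set.range γ)) ≤ d ∧ (∀ i, ∃ P : Polynomial ℤ, P ≠ 0 ∧ P.natDegree ≤ d ∧ (∀ k, |P.coeff k| ≤ (H : ℤ)) ∧ Polynomial.aeval (γ i) P = 0) ∧ (d : ℝ) ≤ c * Δ ∧ Real.log H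 ≤ c * Y ∧ ‖γ - ![(Real.pi : ℂ), (Real.exp 1 : ℂ)]‖ ≤ Real.exp (-((Real.log H * Δ + d * Y) / c)) := by
  sorry

/-- STUB 2 (OPEN, item stmt-Schanuel-14975 of route DiophantineDichotomy): the eventual simultaneous
approximation measure for (π, e) with exponent a < 1. -/
theorem stub_ePiSimultaneousTypeEv : DiophantineDichotomy.EPiSimultaneousTypeEv := by
  sorry

/-- The race (LANDED: `Theorems.ePiRaceEv_proof`) concludes piece X₁ BY NAME from the two stubs. -/
theorem EPiAlgIndependent_of : GaussianStokesSector.EPiAlgIndependent := by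
  have h : DiophantineDichotomy.EPiRaceEv := Summit.Schanuel.Schanuel.Theorems.ePiRaceEv_proof
  unfold DiophantineDichotomy.EPiRaceEv at h
  unfold GaussianStokesSector.EPiAlgIndependent
  exact h stub_approximationPropertyAtEPi stub_ePiSimultaneousTypeEv

end Summit.Schanuel.Schanuel.Cruxes.EPiAlgIndependent.DiophantineRace
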